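/-
Copyright (c) 2026 the pub-hodgecm-mathlib formalisation cell (harness21).  Prover seat hodgecm-mathlib-A-p03 (g25); LEAD F0P3a-plan (g9), map of record
WORD T8-122 (3); LAYER C, θ̄ = 1 AT THE INERT COMPLETION `L_w` — the currency bridge of ★ p842055 (F0P3b-p01 (g6) ∕ F0P3a-p04 (g12)) VERBATIM over the
θ̄ = 1 corner head, 2026-09-01.
-/
import Literature.NumberTheory.Rogawski1990.UnitOrbitalIntegralInertValueThetaOneCorner          -- ★-to-be (this seat): `…_corner_eq_phiOne_of_forall_mul_map_ne`
import Literature.NumberTheory.Automorphic.HyperspecialUnitaryCartanAdicCompletion        -- ★ `localConjDatum_adicCompletion`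
import Literature.NumberTheory.Automorphic.UnitaryGroupIntegralPointsReductionInert       -- ★ `natCard_residueField_eq_sq_of_inert`, `mem_integer_galAdicCompletionMap`
import Literature.NumberTheory.LocalFields.UnramifiedQuadraticNormAtInertPlace           -- ★ `exists_isUnit_map_sub_of_residueHom_ne`
import Literature.LinearAlgebra.Matrix.FiniteFieldHermitianAnisotropic                    -- ★ `exists_frob_ne`
import Literature.NumberTheory.Automorphic.LocalUnitaryGroupCongr                         -- ★ `antidiagOne_eq_over`, `localNonsplitEquiv`
import HarnessLib

/-!
# The `θ̄ = 1` value AT THE INERT COMPLETION `L_w`: `#Fix_{U(L_w)⧸K}(t_π(a,b,c)) = φ₁(N₁, N)` with `q = Nv`, the local frame data discharged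
(Flicker (1998), *Elementary proof of the fundamental lemma for a unitary group*, Prop. 11 p. 87, Props. 12–13 pp. 89–94; Rogawski (1990) §4.9)

Topic `NumberTheory/Rogawski1990` (road «D-N7-inert», MAP v3 LAYER C → (F12) value stubs `X₂ X₃ X₄`, layer (ii-b) for θ̄ = 1); namespace
`Literature.NumberTheory.Automorphic.UnitaryGroup`.  THEOREMS ONLY; kernel lane.  HONEST LABEL: HC_CM is proved only modulo the printed citations until rung 0 closes.

`natCard_fixedPoints_unitaryInt_corner_eq_phiOne_adicCompletion`: at `K = L_w` (`w ∣ v` inert, `v` unramified, `2 ∉ v`), `σ_w = galAdicCompletionMap`, `J_w = placeForm Φ₃ w`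
(= `(StdForm.antidiagonal 3).over L_w`), the hypotheses `hJ hd hσO hq ha₀` of ★ `natCard_fixedPoints_unitaryInt_corner_eq_phiOne_of_forall_mul_map_ne` are DISCHARGED by
the SAME bridge as ★ `natCard_fixedPoints_unitaryInt_corner_eq_phiZero_adicCompletion` (p842055: ★ `localConjDatum_adicCompletion`, ★ `mem_integer_galAdicCompletionMap`,
★ `natCard_residueField_eq_sq_of_inert`, ★ `exists_isUnit_map_sub_of_residueHom_ne` ∘ ★ `exists_frob_ne` ∘ ★ `residueHom_galAdicCompletionMap_eq_pow`, the `ValuativeRel` ↔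
`Valued` integer rings identified by ★ `integer_valuation_eq_adicCompletionIntegers`); what remains: `y` (`y σ_w y = −2`), the literal `t_π(a,b,c)` with norm-one
`a, b, c`, `2e = 1` and Flicker's scalar `π` (`σ_w π = π`, `π π′ = 1`, `π` not a norm), the three orders in `exp` form, `hfin`; the value is
`phiOne (Ideal.absNorm v.asIdeal) N₁ N` (`N = ord(a − c)`, `N₁ = ord(a − b)`).  ONE INSTANCE BINDER `[IsAdicComplete 𝓂[𝒪_w] 𝒪_w]` is carried exactly as in p842055
(payer: ★ p842102 `isAdicComplete_maximalIdeal_adicCompletionIntegers` at the fold).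

## References
* [Flicker1998UnitaryFL] Y. Z. Flicker, *Elementary proof of the fundamental lemma for a unitary group*, Canad. J. Math. 50 (1998), 74–98: Prop. 3 p. 79, Prop. 11 p. 87,
  Props. 12–13 pp. 89–94.
* [Rogawski1990] J. D. Rogawski, *Automorphic Representations of Unitary Groups in Three Variables* (1990), §4.9 p. 55.
* [Serre1979] J.-P. Serre, *Local Fields*, GTM 67 (1979), Ch. V §2 Prop. 3.
-/

set_option autoImplicit false

open scoped MatrixGroups WithZero Valued
open Matrix NumberField IsDedekindDomain

namespace Literature.NumberTheory.Automorphic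

namespace UnitaryGroup

open Literature.NumberTheory.Automorphic.HermitianLattice (unitaryInt mem_unitaryInt_iff LocalConjDatum)
open Literature.NumberTheory.Rogawski1990.Flicker1998 (phiOne)
open IsLocalRing

section AdicCompletion

variable (L : Type) [Field L] [NumberField L] [IsCMField L] {v : HeightOneSpectrum (𝓞 ↥(maximalRealSubfield L))}

set_option synthInstance.maxHeartbeats 200000 in
-- the `H`-action on `H ⧸ (K^{u_m} ∩ H)` (as in ★ (F2))
/-- **`#Fix_{U(L_w)⧸K}(t_π(a,b,c)) = φ₁(N₁, N)` at an inert place, `q = Nv`** (frame data discharged; Flicker's scalar `π` any `σ_w`-fixed non-norm with `π π′ = 1`;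
see the module docstring).  ONE INSTANCE BINDER is carried: `[IsAdicComplete 𝓂[𝒪_w] 𝒪_w]` for the `Valued` integers of `L_w`.
[cite: Flicker1998UnitaryFL, Prop. 11 p. 87; Props. 12–13 pp. 89–94; Prop. 3 p. 79] [cite: Rogawski1990, §4.9 Prop. 4.9.1 (b) p. 55] -/
theorem natCard_fixedPoints_unitaryInt_corner_eq_phiOne_adicCompletion (w : PlacesOver L v) (hw : IsCMField.complexConj L • w.1 = w.1)
    [IsAdicComplete (IsLocalRing.maximalIdeal 𝒪[w.1.adicCompletion L]) 𝒪[w.1.adicCompletion L]]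
    (hv : Algebra.IsUnramifiedIn (𝓞 L) v.asIdeal) (h2 : (2 : 𝓞 ↥(maximalRealSubfield L)) ∉ v.asIdeal)
    {y : w.1.adicCompletion L} (hy : y * galAdicCompletionMap (L := L) (IsCMField.complexConj L) hw y = -2)
    {e a b cc π π' : w.1.adicCompletion L} (h2e : 2 * e = 1) (ha : galAdicCompletionMap (L := L) (IsCMField.complexConj L) hw a * a = 1)
    (hb : galAdicCompletionMap (L := L) (IsCMField.complexConj L) hw b * b = 1) (hcc : galAdicCompletionMap (L := L) (IsCMField.complexConj L) hw cc * cc = 1)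
    (hσπ : galAdicCompletionMap (L := L) (IsCMField.complexConj L) hw π = π) (hππ' : π * π' = 1)
    (hπN : ∀ z : w.1.adicCompletion L, galAdicCompletionMap (L := L) (IsCMField.complexConj L) hw z * z ≠ π)
    {t : ↥(unitaryGroupOfForm (galAdicCompletionMap (L := L) (IsCMField.complexConj L) hw)
      (placeForm (Matrix.of fun i j : Fin 3 => if i.val + j.val + 1 = 3 then (1 : L) else 0) w.1))}
    (hte : ((t : GL (Fin 3) (w.1.adicCompletion L)) : Matrix (Fin 3) (Fin 3) (w.1.adicCompletion L)) =
      !![e * (a + cc), 0, -(e * (a - cc) * π); 0, b, 0; -(e * (a - cc) * π'), 0, e * (a + cc)])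
    {N N₁ N₂ : ℕ} (hN : Valued.v (a - cc) = WithZero.exp (-(N : ℤ))) (hN₁ : Valued.v (a - b) = WithZero.exp (-(N₁ : ℤ)))
    (hN₂ : Valued.v (cc - b) = WithZero.exp (-(N₂ : ℤ)))
    (hfin : {x : ↥(unitaryGroupOfForm (galAdicCompletionMap (L := L) (IsCMField.complexConj L) hw)
        (placeForm (Matrix.of fun i j : Fin 3 => if i.val + j.val + 1 = 3 then (1 : L) else 0) w.1)) ⧸
      unitaryInt (galAdicCompletionMap (L := L) (IsCMField.complexConj L) hw)
        (placeForm (Matrix.of fun i j : Fin 3 => if i.val + j.val + 1 = 3 then (1 : L) else 0) w.1) | t • x = x}.Finite) :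
    (Nat.card {x : ↥(unitaryGroupOfForm (galAdicCompletionMap (L := L) (IsCMField.complexConj L) hw)
        (placeForm (Matrix.of fun i j : Fin 3 => if i.val + j.val + 1 = 3 then (1 : L) else 0) w.1)) ⧸
      unitaryInt (galAdicCompletionMap (L := L) (IsCMField.complexConj L) hw)
        (placeForm (Matrix.of fun i j : Fin 3 => if i.val + j.val + 1 = 3 then (1 : L) else 0) w.1) | t • x = x} : ℚ) =
      phiOne (Ideal.absNorm v.asIdeal) N₁ N := by
  classical
  have hc1 : IsCMField.complexConj L ≠ 1 := IsCMField.complexConj_ne_one L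
  -- `J_w` is the antidiagonal form over `L_w`
  have hJ : placeForm (Matrix.of fun i j : Fin 3 => if i.val + j.val + 1 = 3 then (1 : L) else 0) w.1 =
      (StdForm.antidiagonal 3).over (w.1.adicCompletion L) := by
    rw [placeForm, antidiagOne_eq_over, StdForm.over_map]
  -- the local conjugation datum, `σ_w` on `𝒪`
  obtain ⟨ϖ, hd⟩ := localConjDatum_adicCompletion (IsCMField.complexConj L) hc1 v w hw hv h2
  -- THE CURRENCY BRIDGE: the `ValuativeRel` integers (home of ★ `mem_integer_galAdicCompletionMap`, ★ `natCard_residueField_eq_sq_of_inert`,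
  -- ★ `exists_isUnit_map_sub_of_residueHom_ne`) and the `Valued` integers `𝒪[L_w]` of the Flicker frame are the same subring of `L_w`
  have hO : (ValuativeRel.valuation (w.1.adicCompletion L)).integer = 𝒪[w.1.adicCompletion L] := by
    rw [integer_valuation_eq_adicCompletionIntegers]
    ext x
    simp only [ValuationSubring.mem_toSubring, HeightOneSpectrum.mem_adicCompletionIntegers, Valued.integer, Valuation.mem_integer_iff]
  have hmem : ∀ x : w.1.adicCompletion L, x ∈ (ValuativeRel.valuation (w.1.adicCompletion L)).integer ↔ x ∈ 𝒪[w.1.adicCompletion L] :=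
    fun x => by rw [hO]
  let eO : ↥(ValuativeRel.valuation (w.1.adicCompletion L)).integer ≃+* ↥𝒪[w.1.adicCompletion L] := RingEquiv.subringCongr hO
  have hσO' : ∀ x : ↥(ValuativeRel.valuation (w.1.adicCompletion L)).integer,
      galAdicCompletionMap (L := L) (IsCMField.complexConj L) hw x ∈ (ValuativeRel.valuation (w.1.adicCompletion L)).integer :=
    mem_integer_galAdicCompletionMap (IsCMField.complexConj L) v w hw
  have hσO : ∀ x : 𝒪[w.1.adicCompletion L], galAdicCompletionMap (L := L) (IsCMField.complexConj L) hw x ∈ 𝒪[w.1.adicCompletion L] :=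
    fun x => (hmem _).1 (hσO' ⟨x, (hmem _).2 x.2⟩)
  let σR : ↥(ValuativeRel.valuation (w.1.adicCompletion L)).integer →+* ↥(ValuativeRel.valuation (w.1.adicCompletion L)).integer :=
    ((galAdicCompletionMap (L := L) (IsCMField.complexConj L) hw).comp (ValuativeRel.valuation (w.1.adicCompletion L)).integer.subtype).codRestrict
      (ValuativeRel.valuation (w.1.adicCompletion L)).integer fun x => hσO' x
  let σO : 𝒪[w.1.adicCompletion L] →+* 𝒪[w.1.adicCompletion L] :=
    ((galAdicCompletionMap (L := L) (IsCMField.complexConj L) hw).comp (𝒪[w.1.adicCompletion L]).subtype).codRestrict 𝒪[w.1.adicCompletion L] fun x => hσO x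
  -- `|𝓀_w| = q²` (counted in the `ValuativeRel` presentation, moved by `eO`)
  have hqR := natCard_residueField_eq_sq_of_inert (IsCMField.complexConj L) v hc1 hv w hw
  have hq : Nat.card (ResidueField 𝒪[w.1.adicCompletion L]) = Ideal.absNorm v.asIdeal ^ 2 := by
    rw [← Nat.card_congr (IsLocalRing.ResidueField.mapEquiv eO).toEquiv, hqR, Ideal.absNorm_apply, Submodule.cardQuot_apply]
  -- an integer moved by a unit (found in the `ValuativeRel` presentation, moved by `eO`)
  obtain ⟨σk, hσk⟩ := exists_residueField_ringHom_galAdicCompletionMap (IsCMField.complexConj L) v w hw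
  letI : Fintype (ResidueField ↥(ValuativeRel.valuation (w.1.adicCompletion L)).integer) := Fintype.ofFinite _
  have hq' : Fintype.card (ResidueField ↥(ValuativeRel.valuation (w.1.adicCompletion L)).integer) = Nat.card (𝓞 ↥(maximalRealSubfield L) ⧸ v.asIdeal) ^ 2 := by
    rw [← Nat.card_eq_fintype_card, hqR]
  obtain ⟨a₀, ha₀⟩ := LocalFields.UnramifiedQuadraticNorm.exists_isUnit_map_sub_of_residueHom_ne
    (galAdicCompletionMap (L := L) (IsCMField.complexConj L) hw) (fun x => hσO' x) σk hσk
    (Literature.LinearAlgebra.Matrix.exists_frob_ne hq' σk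
      (residueHom_galAdicCompletionMap_eq_pow (IsCMField.complexConj L) v hc1 hv w hw σk (fun x => hσO' x) hσk))
  have ha₀' : IsUnit (σO (eO a₀) - eO a₀) := by
    have h := (ha₀ : IsUnit (σR a₀ - a₀)).map eO
    rw [map_sub] at h
    convert h using 2
    exact Subtype.ext rfl
  exact natCard_fixedPoints_unitaryInt_corner_eq_phiOne_of_forall_mul_map_ne (galAdicCompletionMap (L := L) (IsCMField.complexConj L) hw) hJ hd
    (fun x => hσO x) hy hq (a₀ := eO a₀) ha₀' h2e ha hb hcc hσπ hππ' hπN hte hN hN₁ hN₂ hfin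

end AdicCompletion

end UnitaryGroup

end Literature.NumberTheory.Automorphic
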